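import Literature.AnabelianGeometry.SemiGraphs.SectionPullbackGlobal
import Literature.AnabelianGeometry.SemiGraphs.SectionPullbackSupport
import Literature.AnabelianGeometry.SemiGraphs.EdgeBasePointTransport

/-!
# Regluing an object over `A` away from the section labels is invisible to `B(𝒢)_{/A} ⥲ B(𝒢′)`
# ([SemiAnbd] §2, Def. 2.2 (i) p. 23, Cor. 2.7 (i) p. 30)

Mochizuki, *Semi-graphs of anabelioids*, Publ. RIMS **42** (2006) 221–322, §2: Def. 2.2 (i) p. 23
("`B′ = B(𝒢)_{G′}`"; the cells of `𝔾′` over `e` are the components of `T_e`), proof of Cor. 2.7 (i) p. 30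
[cite: MochizukiSemiAnbd2006, Cor. 2.7(i) p.30].

abc-iut cell, layer L3, FACT-LIST row F-1487 (`covering_subgraphComponents_doubleCosets` AS TYPED), seat
abc-iut-w4-d080 — assembly of bricks (R3b) `SectionPullbackSupport` and (R4) `SectionPullbackGlobal` of the
tree-free «regluing invisibility» route (`HOME/staging/w4/w4-d080-g7/F1487-MASSBALANCE-MEMO.md` §5).
PROOF-ONLY assembly (the two presentations of the section factorisation are bridged by abc-iut-f-161's
`Hom.reindexIso_hom_app_eq_inv_app`, `EdgeBasePointTransport.lean`):

* `Hom.overIsoOfSupportedReglue` — **THE ENGINE**: for the global clause `(α, e_B)` of a covering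
  `φ : 𝒢′ → 𝒢` attached to `A`, an object `g : B → A` over `A` and a family of twists `θ_b ∈ Aut_{A_e}(B_e)`
  such that at EVERY branch `b′` of `𝒢′` the twist `θ_{φ b′}` is supported away from the tautological
  section (trivial on `B_e ×_{A_e} C_{b′}` for a sub-object `C_{b′} → A_e` through which the section
  `s_{e′}` factors), the reglued object is isomorphic to the original OVER `A`:
  `(B → A) ≅ (B^θ → A)`; `Hom.isoOfSupportedReglue` — the underlying `B ≅ B^θ`;
* `Hom.overIsoOfSupportedReglue'` — the same with the section factorisation written in the presentation
  `s_{e′} ≫ R′` of `TieBijective`.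

Consumers (memo §5 (R5)): take `C_{b′}` := the components of `A_e` other than a fixed cell `Q*` that is not
an edge section label (`Hom.tie_localLabels` (4)); a twist swapping two sheets of `Y ⊔ Y` over `Q*` then
cannot change the isomorphism class over `A` — which it does as soon as the cell is essential.
Nothing here takes a side on [IUTchIII] Cor. 3.12.
-/

namespace Literature.AnabelianGeometry.SemiGraphs

open CategoryTheory CategoryTheory.Limits

-- objects occur under several definitionally equal presentations; let unification see through them.
set_option backward.isDefEq.respectTransparency false

universe v₁ u₁ u

namespace SemiGraphOfAnabelioids

namespace Hom

variable {𝒢' 𝒢 : SemiGraphOfAnabelioids.{v₁, u₁, u}} (φ : Hom 𝒢' 𝒢)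

section Engine

variable {A : 𝒢.BObj} [HasBinaryProducts 𝒢.BObj] (α : Over A ⥤ 𝒢'.BObj) [α.IsEquivalence]
  (eB : φ.pullbackFunctor ≅ Over.star A ⋙ α) {B : 𝒢.BObj} (g : B ⟶ A)
  (θ : ∀ b : 𝒢.graph.Branch, B.T (𝒢.graph.edgeOf b) ≅ B.T (𝒢.graph.edgeOf b))
  (hθ : ∀ b : 𝒢.graph.Branch, (θ b).hom ≫ g.fT (𝒢.graph.edgeOf b) = g.fT (𝒢.graph.edgeOf b))

/-- **The engine: a reglue supported away from the section is invisible over `A`.**  Let `φ : 𝒢′ → 𝒢`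
carry the global clause `(α, e_B)` w.r.t. `A`, let `g : B → A` and let `θ` be a family of twists over `A`.
If at every branch `b′` of `𝒢′` (over `b := φ b′`, `e := e(b)`) there is `m : C → A_e` with `θ_b` the
identity on `B_e ×_{A_e} C` and the tautological section `s_{e′}` factoring through `φ_{e′}^*(m)` (re-indexed
along `e(φ b′) = φ e′`), then `(B → A) ≅ (B^θ → A)` in `B(𝒢)_{/A}`.
[cite: MochizukiSemiAnbd2006, Cor. 2.7(i) p.30] -/
noncomputable def overIsoOfSupportedReglue
    (hsupp : ∀ (b' : 𝒢'.graph.Branch) (v' : 𝒢'.graph.Vertex) (_ : 𝒢'.graph.abuts b' = some v'),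
      ∃ (C : 𝒢.E (𝒢.graph.edgeOf (φ.base.branchMap b')))
        (m : C ⟶ A.T (𝒢.graph.edgeOf (φ.base.branchMap b'))),
        pullback.fst (g.fT (𝒢.graph.edgeOf (φ.base.branchMap b'))) m ≫ (θ (φ.base.branchMap b')).hom =
            pullback.fst (g.fT (𝒢.graph.edgeOf (φ.base.branchMap b'))) m ∧
          ∃ t : (α.obj (Over.mk (𝟙 A))).T (𝒢'.graph.edgeOf b') ⟶
              (φ.φE (𝒢'.graph.edgeOf b') (𝒢.graph.edgeOf (φ.base.branchMap b'))
                (φ.base.edgeOf_branchMap b').symm).pullback.obj C,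
            t ≫ (φ.φE (𝒢'.graph.edgeOf b') (𝒢.graph.edgeOf (φ.base.branchMap b'))
                  (φ.base.edgeOf_branchMap b').symm).pullback.map m ≫
                (φ.reindexIso (𝒢'.graph.edgeOf b') _ _ (φ.base.edgeOf_branchMap b').symm rfl).hom.app A =
              (φ.globalSection α eB).fT (𝒢'.graph.edgeOf b')) :
    Over.mk g ≅ Over.mk (BObj.Hom.reglue g θ hθ) :=
  φ.overIsoOfInvisibleReglue α eB g θ hθ (fun b' v' h' => by
    obtain ⟨C, m, hs, hsec⟩ := hsupp b' v' h'
    exact φ.fst_comp_pullbackTwist_hom_eq (φ.globalSection α eB) g θ b' v' h' m hs hsec)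

/-- The underlying isomorphism `B ≅ B^θ` in `B(𝒢)` of `overIsoOfSupportedReglue`.
[cite: MochizukiSemiAnbd2006, Cor. 2.7(i) p.30] -/
noncomputable def isoOfSupportedReglue
    (hsupp : ∀ (b' : 𝒢'.graph.Branch) (v' : 𝒢'.graph.Vertex) (_ : 𝒢'.graph.abuts b' = some v'),
      ∃ (C : 𝒢.E (𝒢.graph.edgeOf (φ.base.branchMap b')))
        (m : C ⟶ A.T (𝒢.graph.edgeOf (φ.base.branchMap b'))),
        pullback.fst (g.fT (𝒢.graph.edgeOf (φ.base.branchMap b'))) m ≫ (θ (φ.base.branchMap b')).hom =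
            pullback.fst (g.fT (𝒢.graph.edgeOf (φ.base.branchMap b'))) m ∧
          ∃ t : (α.obj (Over.mk (𝟙 A))).T (𝒢'.graph.edgeOf b') ⟶
              (φ.φE (𝒢'.graph.edgeOf b') (𝒢.graph.edgeOf (φ.base.branchMap b'))
                (φ.base.edgeOf_branchMap b').symm).pullback.obj C,
            t ≫ (φ.φE (𝒢'.graph.edgeOf b') (𝒢.graph.edgeOf (φ.base.branchMap b'))
                  (φ.base.edgeOf_branchMap b').symm).pullback.map m ≫
                (φ.reindexIso (𝒢'.graph.edgeOf b') _ _ (φ.base.edgeOf_branchMap b').symm rfl).hom.app A =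
              (φ.globalSection α eB).fT (𝒢'.graph.edgeOf b')) :
    B ≅ B.reglue θ :=
  (Over.forget A).mapIso (φ.overIsoOfSupportedReglue α eB g θ hθ hsupp)

/-- **The engine, `TieBijective` presentation**: as `overIsoOfSupportedReglue`, with the factorisation of
the section written `t ≫ φ_{e′}^*(m) = s_{e′} ≫ R′` (the section re-indexed to the edge `e(φ b′)`, as in
`TieBijective.edgePoint_mem_range_of_sectionE_factors`). [cite: MochizukiSemiAnbd2006, Cor. 2.7(i) p.30] -/
noncomputable def overIsoOfSupportedReglue'
    (hsupp : ∀ (b' : 𝒢'.graph.Branch) (v' : 𝒢'.graph.Vertex) (_ : 𝒢'.graph.abuts b' = some v'),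
      ∃ (C : 𝒢.E (𝒢.graph.edgeOf (φ.base.branchMap b')))
        (m : C ⟶ A.T (𝒢.graph.edgeOf (φ.base.branchMap b'))),
        pullback.fst (g.fT (𝒢.graph.edgeOf (φ.base.branchMap b'))) m ≫ (θ (φ.base.branchMap b')).hom =
            pullback.fst (g.fT (𝒢.graph.edgeOf (φ.base.branchMap b'))) m ∧
          ∃ t : (α.obj (Over.mk (𝟙 A))).T (𝒢'.graph.edgeOf b') ⟶
              (φ.φE (𝒢'.graph.edgeOf b') (𝒢.graph.edgeOf (φ.base.branchMap b'))
                (φ.base.edgeOf_branchMap b').symm).pullback.obj C,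
            t ≫ (φ.φE (𝒢'.graph.edgeOf b') (𝒢.graph.edgeOf (φ.base.branchMap b'))
                  (φ.base.edgeOf_branchMap b').symm).pullback.map m =
              (φ.globalSection α eB).fT (𝒢'.graph.edgeOf b') ≫
                (φ.reindexIso (𝒢'.graph.edgeOf b') _ _ rfl (φ.base.edgeOf_branchMap b').symm).hom.app A) :
    Over.mk g ≅ Over.mk (BObj.Hom.reglue g θ hθ) :=
  φ.overIsoOfSupportedReglue α eB g θ hθ (fun b' v' h' => by
    obtain ⟨C, m, hs, t, ht⟩ := hsupp b' v' h'
    refine ⟨C, m, hs, t, ?_⟩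
    rw [← Category.assoc, ht, Category.assoc, reindexIso_hom_app_eq_inv_app, Iso.inv_hom_id_app]
    exact Category.comp_id _)

end Engine

end Hom

end SemiGraphOfAnabelioids

end Literature.AnabelianGeometry.SemiGraphs
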